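import Summits.QuantumFields.BalabanUV.Beta.GAN24.CombBornBorderContactPairLineage
import Summits.QuantumFields.BalabanUV.Beta.GAN24.CombContactGaugeStaircaseMergedPair
import Summits.QuantumFields.BalabanUV.Beta.GAN24.CombContactKernelCells
import Summits.QuantumFields.BalabanUV.Beta.GAN24.BornBorderContactPairTent

/-!
# `BalabanUV.Beta.GAN24.CombBornBorderContactPairCells` — row G-an2-4 ∕ (CONV-C), TRANSFER-III, the (III′) S-slot (b): **the two CELL LETTERS of the born-V contact pair `hPcV`**
# (`d = 3`, pin `|cE| ≤ Lc^4`, every `cVH`, in-block table root `rt`): the (III′) twins of the `cells_le_top ∕ cells_le_succ` steps of leaf-03 g56's (E) `BornBorderContactPairBound` —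
# the OWNER's `CombBornBorderContactPairLineage.abs_weight_mul_comb_contact_v_pair_le_three` fed, at the TOP pair of lineages (`n = 0`, multiplier legs uncomposed) and at the
# SUCCESSOR pairs (`n = m+1`, multiplier legs composed with the conjugated chains by M.59 `combLegChain_sub_respStep`), with the tree's TABLE-FREE tents ∕ tent pairs
# (`BornBorderContactBound` §1 `legComp_respStep_self`, `abs_legComp_colM ∕ rowMM_zsmul_le`, `exists_legDecay_mulLegs`; `BornBorderContactPairTent` `abs_legComp_colM ∕ rowMM_zsmul_sub_le`)
# and the OWNER's six merged gauge letters `CombContactGaugeStaircaseMergedPair.exists_combGauge_staircase_merged_pair` BY NAME (OWNER `b2b-balaban-gan24-p1` gen 55; `HCV-DESIGN-g55.md` §2).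
# The END (`exists_comb_hCgV_pair_three`, `exists_comb_hPcV_three` = M.104's `hPcV`) is the sequel `CombBornBorderContactPairBound` (split for the 400-line rule).

NOT IN PRINT — OUR BOOKKEEPING ([folklore] assembly BY NAME; 0 `def`, 0 cited fact, 0 `def … : Prop`, 0 sorry; every analytic letter enters as a HYPOTHESIS in its printed form here and is
supplied by the tree in the sequel).
HONEST FRAMING (cell contract, verbatim): «discharging `BetaPertH` makes Bałaban's UV stability UNCONDITIONAL — a real constructive-QFT result; it is NOT the continuum limit
and NOT the Clay problem.»  HONEST DEPENDENCY (verbatim): «continuum YM on T⁴ ⇐ BetaPertH ∧ nine spine estimates (0/9 proved); BetaPertH ⇐ (D1) ∧ (D4) ∧ CAP+tail; G-an2-4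
gates asym, D1 and NE2/3/4.»  WHAT THIS DISCHARGES AND WHAT NOT: two bookkeeping cells of the pair letter `hPcV`; NOT `hPcV` itself (sequel), NOT (hS, hSall), NOT the END; NEVER
«G-an2-4 closed» as (CONV-C); NOT D1, NOT BetaPertH, NOT continuum, NOT Clay.  2026-08-28; no existing file touched.

## What is proved (`d = 3`, `2 ≤ Lc`)
`pair_cells_le_top` (top pair of lineages, `n = 0`), `pair_cells_le_succ` (successor pairs, `n = m+1`, `m < M`).
-/

noncomputable section

open scoped BigOperators
open Literature.MathematicalPhysics.QuantumFieldTheory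
open Literature.MathematicalPhysics.QuantumFieldTheory.LatticeForm (quo)
open Literature.MathematicalPhysics.QuantumFieldTheory.Balaban1983to89
open Literature.MathematicalPhysics.QuantumFieldTheory.Balaban1983to89.Beta
open B4ContourShift (supNorm supNorm_nonneg)
open B12Sec2to5 (l1 l1_nonneg)
open ExpKernelCalculus (MKer Decays Zl Zl_nonneg)
open AffineAveraging (Form1 Site box toSite)
open AveragingHessianKernels (ell)
open Summit.QuantumFields.BalabanUV.Beta.SymAveragingHessianCounts (symVhSAt)
open Summit.QuantumFields.BalabanUV.Beta.SymCorrectorKernel (psiKS)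
open Summit.QuantumFields.BalabanUV.Beta.SymCorrectorFace (faceWtSum faceWtSum_nonneg)
open AveragingContoursRooted (ctr ctrOff ctrOff_mem_box)
open AveragingContours (blk)
open KKTFluctuationKernel (delta1)
open Summit.QuantumFields.BalabanUV.Beta.AxialProjectorBlockMean (bmGaugeAt)
open Summit.QuantumFields.BalabanUV.Beta.GAN24.RespStepBmDecompPsi (Psi)
open Summit.QuantumFields.BalabanUV.Beta.GAN24.CombLegChainGauge (PsiFace)
open OneStepResolventKernel (Fib LocStencil)
open BalabanCompositeJets (respStep)
open Summit.QuantumFields.BalabanUV.Beta.GAN24.CombesThomas (sfStep smStep KStepUnit UnitDecayK CauchyDecayK SupBound)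
open Summit.QuantumFields.BalabanUV.Beta.GAN24.Push4 (legComp)
open Summit.QuantumFields.BalabanUV.Beta.GAN24.Push4Bounds (LegDecay)
open Summit.QuantumFields.BalabanUV.Beta.GAN24.Push4Iter (legChain)
open Summit.QuantumFields.BalabanUV.Beta.GAN24.Push3 (push₃)
open Summit.QuantumFields.BalabanUV.Beta.GAN24.RespStepBmDecompPsi (decays_KStepUnit_levels)
open Summit.QuantumFields.BalabanUV.Beta.GAN24.RespStepBmDecompExact (respStepBmSeq)
open Summit.QuantumFields.BalabanUV.Beta.GAN24.SrecLinearPartEq (colM rowMM reslot legDecay_colM legDecay_rowMM)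
open Summit.QuantumFields.BalabanUV.Beta.GAN24.UndressedResponseUnits (inv_cast_pow_pow)
open Summit.QuantumFields.BalabanUV.Beta.GAN24.CombContactKernelCells (combLegChain_sub_respStep)
open Summit.QuantumFields.BalabanUV.Beta.GAN24.CombContactGaugeStaircaseMergedPair (exists_combGauge_staircase_merged_pair)
open Summit.QuantumFields.BalabanUV.Beta.GAN24.BornBorderContactBound (legComp_respStep_self abs_legComp_colM_zsmul_le abs_legComp_rowMM_zsmul_le exists_legDecay_mulLegs)
open Summit.QuantumFields.BalabanUV.Beta.GAN24.BornBorderContactPairTent (abs_legComp_colM_zsmul_sub_le abs_legComp_rowMM_zsmul_sub_le)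
open Summit.QuantumFields.BalabanUV.Beta.GAN24.CombBornBorderContactPairLineage (abs_weight_mul_comb_contact_v_pair_le_three)

namespace Summit.QuantumFields.BalabanUV.Beta.GAN24.CombBornBorderContactPairCells

section Cells

variable {Lc : ℕ} [NeZero Lc]

set_option maxHeartbeats 800000 in
/-- NOT IN PRINT; OUR BOOKKEEPING ([folklore] plumbing, `d = 3`).  **THE PAIR OF TOP LINEAGES** (`n = 0`: births `i`, `i+1` in members `i+1`, `i+2`; multiplier legs `colM ∕ rowMM K̃_j Lc`
uncomposed): (C) `abs_weight_mul_contact_v_pair_le_three` at `n = 0` with the tree letters as HYPOTHESES in their printed forms ((N1), CT-4a, the dressed envelope, the K-slot's `hK ∕ hKall`):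
undressed-leg pair `c·θ₁^{i+0}` (CT-4a at `(s,k) = (i,0)`), differenced staircase pieces (Pack §A `abs_gaugePieceSucc_le`), tents `Cst·e^{δ}` ((D⁻) §1 + `legComp_respStep_self`), tent
pairs `cK·θ₂^{i}·e^{δ}` (§1). -/
theorem pair_cells_le_top (hLc : 2 ≤ Lc) {rt : Fin (3 + 1) → ℕ} (hrt : rt ∈ box (3 + 1) Lc) {cE cVH : ℝ} (hcE : |cE| ≤ (Lc : ℝ) ^ 4)
    {C₁ κ₁ c θ₁ KE κE Cst δ cK θ₂ : ℝ}
    (hN1 : ∀ (m k : ℕ) (μ : Fin (3 + 1)) (z : Site (3 + 1)) (l'' : Fin (3 + 1)) (w' : Site (3 + 1)),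
      |respStep (d := 3) (Lc ^ m) (Lc ^ (m + k + 1)) μ z l'' w'| ≤
        C₁ * ((Lc : ℝ) ^ (5 * (k + 1)))⁻¹ * Real.exp (-(κ₁ * supNorm (quo (Lc ^ (k + 1)) w' - z))))
    (hκ₁ : 0 < κ₁) (hC₁ : 0 ≤ C₁)
    (hCau : ∀ (s k : ℕ) (μ : Fin (3 + 1)) (z : Site (3 + 1)) (l : Fin (3 + 1)) (w : Site (3 + 1)),
      |respStep (d := 3) (Lc ^ (s + 1)) (Lc ^ (s + k + 2)) μ z l w - respStep (d := 3) (Lc ^ s) (Lc ^ (s + k + 1)) μ z l w|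
        ≤ c * θ₁ ^ (s + k) * ((((Lc ^ (k + 1) : ℕ) : ℝ)) ^ (3 + 2))⁻¹ * Real.exp (-(κ₁ * supNorm (quo (Lc ^ (k + 1)) w - z))))
    (hc : 0 ≤ c) (hθ₁ : 0 ≤ θ₁)
    (hEnv : ∀ (m k : ℕ) (μ : Fin (3 + 1)) (z : Site (3 + 1)) (κ : Fin (3 + 1)) (u : Site (3 + 1)),
      |legChain (fun j => legComp (fun α x κ u => psiKS (ctrOff (3 + 1) Lc) Lc u x (Sum.inl κ) (Sum.inl α)) (respStepBmSeq (d := 3) (ctr (3 + 1) Lc) Lc j)) m k μ z κ u| ≤ KE * ((k : ℝ) + 1) * ((Lc : ℝ) ^ (4 * (k + 1)))⁻¹ * Real.exp (-(κE * supNorm (quo (Lc ^ (k + 1)) u - z))))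
    (hκE : 0 < κE) (hK : UnitDecayK 3 Lc (sfStep Lc) (smStep 3 Lc) Cst δ) (hKall : CauchyDecayK 3 Lc (sfStep Lc) (smStep 3 Lc) cK θ₂ δ) (hδ : 0 < δ)
    (hcK : 0 ≤ cK) (hθ₂ : 0 ≤ θ₂) (i : ℕ) (κ' : Fin (3 + 1)) (u' x z : Site (3 + 1)) (a b : Fib 3) :
    |(cE * (Lc : ℝ) ^ (2 * (3 + 1))) ^ (0 + 1) *
        (((push₃ (-legChain (fun j => legComp (fun α x κ u => psiKS (ctrOff (3 + 1) Lc) Lc u x (Sum.inl κ) (Sum.inl α)) (respStepBmSeq (d := 3) (ctr (3 + 1) Lc) Lc j)) (i + 1) 0) (colM (KStepUnit (d := 3) Lc (i + 1)) Lc) (legChain (fun j => legComp (fun α x κ u => psiKS (ctrOff (3 + 1) Lc) Lc u x (Sum.inl κ) (Sum.inl α)) (respStepBmSeq (d := 3) (ctr (3 + 1) Lc) Lc j)) (i + 1) 0)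
                (reslot Sum.inl Sum.inr fun κ u => cVH • symVhSAt (toSite rt) 3 Lc rfl κ u) κ' u' x z a b
              - push₃ (-respStep (d := 3) (Lc ^ (i + 1)) (Lc ^ (i + 1 + 0 + 1))) (colM (KStepUnit (d := 3) Lc (i + 1)) Lc) (respStep (d := 3) (Lc ^ (i + 1)) (Lc ^ (i + 1 + 0 + 1)))
                (reslot Sum.inl Sum.inr fun κ u => cVH • symVhSAt (toSite rt) 3 Lc rfl κ u) κ' u' x z a b)
            + (push₃ (rowMM (KStepUnit (d := 3) Lc (i + 1)) Lc) (legChain (fun j => legComp (fun α x κ u => psiKS (ctrOff (3 + 1) Lc) Lc u x (Sum.inl κ) (Sum.inl α)) (respStepBmSeq (d := 3) (ctr (3 + 1) Lc) Lc j)) (i + 1) 0) (legChain (fun j => legComp (fun α x κ u => psiKS (ctrOff (3 + 1) Lc) Lc u x (Sum.inl κ) (Sum.inl α)) (respStepBmSeq (d := 3) (ctr (3 + 1) Lc) Lc j)) (i + 1) 0)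
                (reslot Sum.inr Sum.inl fun κ u => cVH • symVhSAt (toSite rt) 3 Lc rfl κ u) κ' u' x z a b
              - push₃ (rowMM (KStepUnit (d := 3) Lc (i + 1)) Lc) (respStep (d := 3) (Lc ^ (i + 1)) (Lc ^ (i + 1 + 0 + 1))) (respStep (d := 3) (Lc ^ (i + 1)) (Lc ^ (i + 1 + 0 + 1)))
                (reslot Sum.inr Sum.inl fun κ u => cVH • symVhSAt (toSite rt) 3 Lc rfl κ u) κ' u' x z a b))
          - ((push₃ (-legChain (fun j => legComp (fun α x κ u => psiKS (ctrOff (3 + 1) Lc) Lc u x (Sum.inl κ) (Sum.inl α)) (respStepBmSeq (d := 3) (ctr (3 + 1) Lc) Lc j)) i 0) (colM (KStepUnit (d := 3) Lc i) Lc) (legChain (fun j => legComp (fun α x κ u => psiKS (ctrOff (3 + 1) Lc) Lc u x (Sum.inl κ) (Sum.inl α)) (respStepBmSeq (d := 3) (ctr (3 + 1) Lc) Lc j)) i 0)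
                (reslot Sum.inl Sum.inr fun κ u => cVH • symVhSAt (toSite rt) 3 Lc rfl κ u) κ' u' x z a b
              - push₃ (-respStep (d := 3) (Lc ^ i) (Lc ^ (i + 0 + 1))) (colM (KStepUnit (d := 3) Lc i) Lc) (respStep (d := 3) (Lc ^ i) (Lc ^ (i + 0 + 1)))
                (reslot Sum.inl Sum.inr fun κ u => cVH • symVhSAt (toSite rt) 3 Lc rfl κ u) κ' u' x z a b)
            + (push₃ (rowMM (KStepUnit (d := 3) Lc i) Lc) (legChain (fun j => legComp (fun α x κ u => psiKS (ctrOff (3 + 1) Lc) Lc u x (Sum.inl κ) (Sum.inl α)) (respStepBmSeq (d := 3) (ctr (3 + 1) Lc) Lc j)) i 0) (legChain (fun j => legComp (fun α x κ u => psiKS (ctrOff (3 + 1) Lc) Lc u x (Sum.inl κ) (Sum.inl α)) (respStepBmSeq (d := 3) (ctr (3 + 1) Lc) Lc j)) i 0)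
                (reslot Sum.inr Sum.inl fun κ u => cVH • symVhSAt (toSite rt) 3 Lc rfl κ u) κ' u' x z a b
              - push₃ (rowMM (KStepUnit (d := 3) Lc i) Lc) (respStep (d := 3) (Lc ^ i) (Lc ^ (i + 0 + 1))) (respStep (d := 3) (Lc ^ i) (Lc ^ (i + 0 + 1)))
                (reslot Sum.inr Sum.inl fun κ u => cVH • symVhSAt (toSite rt) 3 Lc rfl κ u) κ' u' x z a b)))|
      ≤ |cVH| * (2 * ((Lc : ℝ) ^ 3 * (((((3 + 1).factorial : ℕ) : ℝ) * (Lc : ℝ) ^ (3 + 1))⁻¹ * (((3 : ℝ) + 1) * (Real.exp (2 * ((3 : ℝ) + 1) * min (min δ κ₁) κ₁) ^ 2 *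
              (((2 * Lc : ℕ) : ℝ) ^ (3 + 1) * (((3 + 1 : ℕ) : ℝ) * ((((3 + 1).factorial : ℕ) : ℝ) * ((Lc : ℝ) ^ (3 + 1) * (ell (3 + 1) Lc : ℝ)))))))
            * ((2 * (Cst * Real.exp δ) * C₁ * (c * θ₁ ^ (i + 0)) + (cK * θ₂ ^ i * Real.exp δ) * C₁ ^ 2) * (4 * ((8 * (Lc : ℝ) + faceWtSum (ctrOff (3 + 1) Lc) Lc * (1 + 8 * (Lc : ℝ) * (Real.exp κ₁ + 1))) * (1 + (Lc : ℝ))) + 4 * ((8 * (Lc : ℝ) + faceWtSum (ctrOff (3 + 1) Lc) Lc * (1 + 8 * (Lc : ℝ) * (Real.exp κ₁ + 1))) * (1 + (Lc : ℝ))) ^ 2 + 4 * ((8 * (Lc : ℝ) + faceWtSum (ctrOff (3 + 1) Lc) Lc * (1 + 8 * (Lc : ℝ) * (Real.exp κ₁ + 1))) * (1 + (Lc : ℝ))) * Lc + 8 * ((8 * (Lc : ℝ) + faceWtSum (ctrOff (3 + 1) Lc) Lc * (1 + 8 * (Lc : ℝ) * (Real.exp κ₁ + 1))) * (1 + (Lc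 : ℝ))) ^ 2 * Lc))
            * Zl (3 + 1) (min (min δ κ₁) κ₁ / (4 * ((3 : ℝ) + 1))))))
          * ((((0 : ℕ) : ℝ) + 1) * ((Lc : ℝ)⁻¹) ^ (0 + 1))
          * Real.exp (-(min (min δ κ₁) κ₁ / 12 / 2 / ((3 : ℝ) + 1)) * (l1 (x - u') + l1 (z - u'))) := by
  have hCst : 0 ≤ Cst := (hK 0).nonneg (Sum.inl 0)
  have hTb : 0 ≤ Cst * Real.exp δ := by positivity
  have hE : ∀ μ z' l u, |legChain (fun j => legComp (fun α x κ u => psiKS (ctrOff (3 + 1) Lc) Lc u x (Sum.inl κ) (Sum.inl α)) (respStepBmSeq (d := 3) (ctr (3 + 1) Lc) Lc j)) i 0 μ z' l u|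
      ≤ (KE * (((0 : ℕ) : ℝ) + 1) * ((Lc : ℝ) ^ (4 * (0 + 1)))⁻¹) * Real.exp (-(κE * supNorm (quo (Lc ^ (0 + 1)) u - z'))) :=
    fun μ z' l u => hEnv i 0 μ z' l u
  have hEp : ∀ μ z' l u, |legChain (fun j => legComp (fun α x κ u => psiKS (ctrOff (3 + 1) Lc) Lc u x (Sum.inl κ) (Sum.inl α)) (respStepBmSeq (d := 3) (ctr (3 + 1) Lc) Lc j)) (i + 1) 0 μ z' l u|
      ≤ (KE * (((0 : ℕ) : ℝ) + 1) * ((Lc : ℝ) ^ (4 * (0 + 1)))⁻¹) * Real.exp (-(κE * supNorm (quo (Lc ^ (0 + 1)) u - z'))) :=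
    fun μ z' l u => hEnv (i + 1) 0 μ z' l u
  have hBΔ : ∀ (μ : Fin (3 + 1)) (z : Site (3 + 1)) (l : Fin (3 + 1)) (u : Site (3 + 1)),
      |respStep (d := 3) (Lc ^ (i + 1)) (Lc ^ (i + 1 + 0 + 1)) μ z l u - respStep (d := 3) (Lc ^ i) (Lc ^ (i + 0 + 1)) μ z l u|
        ≤ (c * θ₁ ^ (i + 0)) * ((Lc : ℝ) ^ (5 * (0 + 1)))⁻¹ * Real.exp (-(κ₁ * supNorm (quo (Lc ^ (0 + 1)) u - z))) := by
    intro μ z l u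
    have h := hCau i 0 μ z l u
    rw [inv_cast_pow_pow, show i + 0 + 2 = i + 1 + 0 + 1 by ring] at h
    simpa only [mul_assoc] using h
  have hr : ctrOff (3 + 1) Lc ∈ box (3 + 1) Lc := ctrOff_mem_box (le_trans (by norm_num) hLc)
  have hA : 0 ≤ ((8 * (Lc : ℝ) + faceWtSum (ctrOff (3 + 1) Lc) Lc * (1 + 8 * (Lc : ℝ) * (Real.exp κ₁ + 1))) * (1 + (Lc : ℝ))) := by
    have hF0 := faceWtSum_nonneg (ctrOff (3 + 1) Lc) Lc
    positivity
  have hTB := combLegChain_sub_respStep (d := 3) (Lc := Lc) hr hr i 0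
  have hTBp := combLegChain_sub_respStep (d := 3) (Lc := Lc) hr hr (i + 1) 0
  obtain ⟨G, Gp, GΔ, hψ', hG', hψp', hGp', hψΔ', hGΔ'⟩ :=
    exists_combGauge_staircase_merged_pair (Lc := Lc) hκ₁.le hC₁ hκ₁.le hc hθ₁ hN1 hCau hr hr le_rfl i 0
  have hψ : ∀ (μ₀ : Fin (3 + 1)) (z₀ u : Site (3 + 1)),
      (Psi (toSite (ctrOff (3 + 1) Lc)) Lc i 0 (delta1 μ₀ z₀) + PsiFace (ctrOff (3 + 1) Lc) (toSite (ctrOff (3 + 1) Lc)) Lc i 0 (delta1 μ₀ z₀)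
          - bmGaugeAt (toSite (ctrOff (3 + 1) Lc)) (respStep (d := 3) (Lc ^ i) (Lc ^ (i + 0 + 1)) μ₀ z₀) Lc) u
        = ∑ s ∈ Finset.range (0 + 1), G μ₀ z₀ s (blk (Lc ^ s) u) := fun μ₀ z₀ u => by
    simpa only [Pi.add_apply, Pi.sub_apply] using hψ' μ₀ z₀ u
  have hψq : ∀ (μ₀ : Fin (3 + 1)) (z₀ u : Site (3 + 1)),
      (Psi (toSite (ctrOff (3 + 1) Lc)) Lc (i + 1) 0 (delta1 μ₀ z₀) + PsiFace (ctrOff (3 + 1) Lc) (toSite (ctrOff (3 + 1) Lc)) Lc (i + 1) 0 (delta1 μ₀ z₀)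
          - bmGaugeAt (toSite (ctrOff (3 + 1) Lc)) (respStep (d := 3) (Lc ^ (i + 1)) (Lc ^ (i + 1 + 0 + 1)) μ₀ z₀) Lc) u
        = ∑ s ∈ Finset.range (0 + 1), Gp μ₀ z₀ s (blk (Lc ^ s) u) := fun μ₀ z₀ u => by
    simpa only [Pi.add_apply, Pi.sub_apply] using hψp' μ₀ z₀ u
  have hψΔ : ∀ (μ₀ : Fin (3 + 1)) (z₀ u : Site (3 + 1)),
      (Psi (toSite (ctrOff (3 + 1) Lc)) Lc (i + 1) 0 (delta1 μ₀ z₀) + PsiFace (ctrOff (3 + 1) Lc) (toSite (ctrOff (3 + 1) Lc)) Lc (i + 1) 0 (delta1 μ₀ z₀)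
          - bmGaugeAt (toSite (ctrOff (3 + 1) Lc)) (respStep (d := 3) (Lc ^ (i + 1)) (Lc ^ (i + 1 + 0 + 1)) μ₀ z₀) Lc) u
        - (Psi (toSite (ctrOff (3 + 1) Lc)) Lc i 0 (delta1 μ₀ z₀) + PsiFace (ctrOff (3 + 1) Lc) (toSite (ctrOff (3 + 1) Lc)) Lc i 0 (delta1 μ₀ z₀)
          - bmGaugeAt (toSite (ctrOff (3 + 1) Lc)) (respStep (d := 3) (Lc ^ i) (Lc ^ (i + 0 + 1)) μ₀ z₀) Lc) u
        = ∑ s ∈ Finset.range (0 + 1), GΔ μ₀ z₀ s (blk (Lc ^ s) u) := fun μ₀ z₀ u => by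
    simpa only [Pi.add_apply, Pi.sub_apply] using hψΔ' μ₀ z₀ u
  have hGA : ∀ (μ₀ : Fin (3 + 1)) (z₀ : Site (3 + 1)) (s : ℕ), s ≤ 0 → ∀ u : Site (3 + 1),
      |G μ₀ z₀ s (blk (Lc ^ s) u)| ≤ ((8 * (Lc : ℝ) + faceWtSum (ctrOff (3 + 1) Lc) Lc * (1 + 8 * (Lc : ℝ) * (Real.exp κ₁ + 1))) * (1 + (Lc : ℝ))) * C₁ * ((Lc : ℝ) ^ (5 * (0 + 1)))⁻¹ * (Lc : ℝ) ^ s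
        * Real.exp (-(κ₁ * supNorm (quo (Lc ^ (0 + 1)) u - z₀))) := fun μ₀ z₀ s hs u =>
    (hG' μ₀ z₀ s hs u).trans (le_of_eq (by ring))
  have hGqA : ∀ (μ₀ : Fin (3 + 1)) (z₀ : Site (3 + 1)) (s : ℕ), s ≤ 0 → ∀ u : Site (3 + 1),
      |Gp μ₀ z₀ s (blk (Lc ^ s) u)| ≤ ((8 * (Lc : ℝ) + faceWtSum (ctrOff (3 + 1) Lc) Lc * (1 + 8 * (Lc : ℝ) * (Real.exp κ₁ + 1))) * (1 + (Lc : ℝ))) * C₁ * ((Lc : ℝ) ^ (5 * (0 + 1)))⁻¹ * (Lc : ℝ) ^ s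
        * Real.exp (-(κ₁ * supNorm (quo (Lc ^ (0 + 1)) u - z₀))) := fun μ₀ z₀ s hs u =>
    (hGp' μ₀ z₀ s hs u).trans (le_of_eq (by ring))
  have hGΔ : ∀ (μ₀ : Fin (3 + 1)) (z₀ : Site (3 + 1)) (s : ℕ), s ≤ 0 → ∀ u : Site (3 + 1),
      |GΔ μ₀ z₀ s (blk (Lc ^ s) u)| ≤ ((8 * (Lc : ℝ) + faceWtSum (ctrOff (3 + 1) Lc) Lc * (1 + 8 * (Lc : ℝ) * (Real.exp κ₁ + 1))) * (1 + (Lc : ℝ))) * (c * θ₁ ^ (i + 0)) * ((Lc : ℝ) ^ (5 * (0 + 1)))⁻¹ * (Lc : ℝ) ^ s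
        * Real.exp (-(κ₁ * supNorm (quo (Lc ^ (0 + 1)) u - z₀))) := fun μ₀ z₀ s hs u =>
    (hGΔ' μ₀ z₀ s hs u).trans (le_of_eq (by ring))
  obtain ⟨CK, mK, hmK, hKi⟩ := decays_KStepUnit_levels (d := 3) (Lc := Lc) i
  obtain ⟨CKp, mKp, hmKp, hKip⟩ := decays_KStepUnit_levels (d := 3) (Lc := Lc) (i + 1)
  have hcol : LegDecay (colM (KStepUnit (d := 3) Lc i) Lc) Lc CK mK := legDecay_colM hKi
  have hrow : LegDecay (rowMM (KStepUnit (d := 3) Lc i) Lc) Lc CK mK := legDecay_rowMM hKi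
  have hcolp : LegDecay (colM (KStepUnit (d := 3) Lc (i + 1)) Lc) Lc CKp mKp := legDecay_colM hKip
  have hrowp : LegDecay (rowMM (KStepUnit (d := 3) Lc (i + 1)) Lc) Lc CKp mKp := legDecay_rowMM hKip
  have hMt : ∀ (a : Fin (3 + 1)) (b : Site (3 + 1)) (μ : Fin (3 + 1)) (y : Site (3 + 1)),
      |colM (KStepUnit (d := 3) Lc i) Lc a b μ ((Lc : ℤ) • y)| ≤ Cst * Real.exp δ
        * ((((Lc : ℝ) ^ 0) ^ (2 * 3 + 1))⁻¹) * Real.exp (-(δ * supNorm (quo (Lc ^ 0) y - b))) := by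
    intro a b μ y
    have h := abs_legComp_colM_zsmul_le hK hδ.le i 0 a b μ y
    simp only [Nat.add_zero, legComp_respStep_self] at h
    exact h
  have hMpt : ∀ (a : Fin (3 + 1)) (b : Site (3 + 1)) (μ : Fin (3 + 1)) (y : Site (3 + 1)),
      |colM (KStepUnit (d := 3) Lc (i + 1)) Lc a b μ ((Lc : ℤ) • y)| ≤ Cst * Real.exp δ
        * ((((Lc : ℝ) ^ 0) ^ (2 * 3 + 1))⁻¹) * Real.exp (-(δ * supNorm (quo (Lc ^ 0) y - b))) := by
    intro a b μ y
    have h := abs_legComp_colM_zsmul_le hK hδ.le (i + 1) 0 a b μ y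
    simp only [Nat.add_zero, legComp_respStep_self] at h
    exact h
  have hMΔt : ∀ (a : Fin (3 + 1)) (b : Site (3 + 1)) (μ : Fin (3 + 1)) (y : Site (3 + 1)),
      |colM (KStepUnit (d := 3) Lc (i + 1)) Lc a b μ ((Lc : ℤ) • y) - colM (KStepUnit (d := 3) Lc i) Lc a b μ ((Lc : ℤ) • y)|
        ≤ (cK * θ₂ ^ i * Real.exp δ) * ((((Lc : ℝ) ^ 0) ^ (2 * 3 + 1))⁻¹) * Real.exp (-(δ * supNorm (quo (Lc ^ 0) y - b))) := by
    intro a b μ y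
    have h := abs_legComp_colM_zsmul_sub_le hKall hδ.le hcK hθ₂ i 0 a b μ y
    simp only [Nat.add_zero, legComp_respStep_self] at h
    exact h
  have hM't : ∀ (a : Fin (3 + 1)) (b : Site (3 + 1)) (μ : Fin (3 + 1)) (y : Site (3 + 1)),
      |rowMM (KStepUnit (d := 3) Lc i) Lc a b μ ((Lc : ℤ) • y)| ≤ Cst * Real.exp δ
        * ((((Lc : ℝ) ^ 0) ^ (2 * 3 + 1))⁻¹) * Real.exp (-(δ * supNorm (quo (Lc ^ 0) y - b))) := by
    intro a b μ y
    have h := abs_legComp_rowMM_zsmul_le hK hδ.le i 0 a b μ y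
    simp only [Nat.add_zero, legComp_respStep_self] at h
    exact h
  have hM'Δt : ∀ (a : Fin (3 + 1)) (b : Site (3 + 1)) (μ : Fin (3 + 1)) (y : Site (3 + 1)),
      |rowMM (KStepUnit (d := 3) Lc (i + 1)) Lc a b μ ((Lc : ℤ) • y) - rowMM (KStepUnit (d := 3) Lc i) Lc a b μ ((Lc : ℤ) • y)|
        ≤ (cK * θ₂ ^ i * Real.exp δ) * ((((Lc : ℝ) ^ 0) ^ (2 * 3 + 1))⁻¹) * Real.exp (-(δ * supNorm (quo (Lc ^ 0) y - b))) := by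
    intro a b μ y
    have h := abs_legComp_rowMM_zsmul_sub_le hKall hδ.le hcK hθ₂ i 0 a b μ y
    simp only [Nat.add_zero, legComp_respStep_self] at h
    exact h
  exact abs_weight_mul_comb_contact_v_pair_le_three (cVH := cVH) (i := i) (n := 0) hLc hrt hcE hN1 hκ₁ hC₁ hκ₁ (by positivity : 0 ≤ c * θ₁ ^ (i + 0)) hBΔ hA hTB hTBp hψ hψq hψΔ hGA hGqA hGΔ hE hEp hκE
    (hcol.summable hmK) (hcolp.summable hmKp) hMt hMpt hMΔt (fun a b μ z => hrow.abs_le hmK.le a b μ z) (hrow.summable hmK)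
    (fun a b μ z => hrowp.abs_le hmKp.le a b μ z) (hrowp.summable hmKp) hM't hM'Δt hδ hTb (by positivity) κ' u' x z a b

set_option maxHeartbeats 800000 in
/-- NOT IN PRINT; OUR BOOKKEEPING ([folklore] plumbing, `d = 3`).  **THE PAIR OF NESTED LINEAGES** (`n = m+1`: composite multiplier legs `legComp (colM ∕ rowMM K̃_j Lc) (respStep …)`):
(C) at `n = m+1` with the tree letters as HYPOTHESES in their printed forms; tents ((D⁻) §1 `abs_legComp_colM∕rowMM_zsmul_le`), tent pairs (§1), localisation by (D⁻) §1
`exists_legDecay_mulLegs` at births `i`, `i+1`. -/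
theorem pair_cells_le_succ (hLc : 2 ≤ Lc) {rt : Fin (3 + 1) → ℕ} (hrt : rt ∈ box (3 + 1) Lc) {cE cVH : ℝ} (hcE : |cE| ≤ (Lc : ℝ) ^ 4)
    {C₁ κ₁ c θ₁ KE κE Cst δ cK θ₂ : ℝ}
    (hN1 : ∀ (m k : ℕ) (μ : Fin (3 + 1)) (z : Site (3 + 1)) (l'' : Fin (3 + 1)) (w' : Site (3 + 1)),
      |respStep (d := 3) (Lc ^ m) (Lc ^ (m + k + 1)) μ z l'' w'| ≤
        C₁ * ((Lc : ℝ) ^ (5 * (k + 1)))⁻¹ * Real.exp (-(κ₁ * supNorm (quo (Lc ^ (k + 1)) w' - z))))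
    (hκ₁ : 0 < κ₁) (hC₁ : 0 ≤ C₁)
    (hCau : ∀ (s k : ℕ) (μ : Fin (3 + 1)) (z : Site (3 + 1)) (l : Fin (3 + 1)) (w : Site (3 + 1)),
      |respStep (d := 3) (Lc ^ (s + 1)) (Lc ^ (s + k + 2)) μ z l w - respStep (d := 3) (Lc ^ s) (Lc ^ (s + k + 1)) μ z l w|
        ≤ c * θ₁ ^ (s + k) * ((((Lc ^ (k + 1) : ℕ) : ℝ)) ^ (3 + 2))⁻¹ * Real.exp (-(κ₁ * supNorm (quo (Lc ^ (k + 1)) w - z))))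
    (hc : 0 ≤ c) (hθ₁ : 0 ≤ θ₁)
    (hEnv : ∀ (m k : ℕ) (μ : Fin (3 + 1)) (z : Site (3 + 1)) (κ : Fin (3 + 1)) (u : Site (3 + 1)),
      |legChain (fun j => legComp (fun α x κ u => psiKS (ctrOff (3 + 1) Lc) Lc u x (Sum.inl κ) (Sum.inl α)) (respStepBmSeq (d := 3) (ctr (3 + 1) Lc) Lc j)) m k μ z κ u| ≤ KE * ((k : ℝ) + 1) * ((Lc : ℝ) ^ (4 * (k + 1)))⁻¹ * Real.exp (-(κE * supNorm (quo (Lc ^ (k + 1)) u - z))))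
    (hκE : 0 < κE) (hK : UnitDecayK 3 Lc (sfStep Lc) (smStep 3 Lc) Cst δ) (hKall : CauchyDecayK 3 Lc (sfStep Lc) (smStep 3 Lc) cK θ₂ δ) (hδ : 0 < δ)
    (hcK : 0 ≤ cK) (hθ₂ : 0 ≤ θ₂) (i m : ℕ) (κ' : Fin (3 + 1)) (u' x z : Site (3 + 1)) (a b : Fib 3) :
    |(cE * (Lc : ℝ) ^ (2 * (3 + 1))) ^ ((m + 1) + 1) *
        (((push₃ (-legChain (fun j => legComp (fun α x κ u => psiKS (ctrOff (3 + 1) Lc) Lc u x (Sum.inl κ) (Sum.inl α)) (respStepBmSeq (d := 3) (ctr (3 + 1) Lc) Lc j)) (i + 1) (m + 1)) (legComp (colM (KStepUnit (d := 3) Lc (i + 1)) Lc) (respStep (d := 3) (Lc ^ (i + 1 + 1)) (Lc ^ (i + 1 + (m + 1) + 1)))) (legChain (fun j => legComp (fun α x κ u => psiKS (ctrOff (3 + 1) Lc) Lc u x (Sum.inl κ) (Sum.inl α)) (respStepBmSeq (d := 3) (ctr (3 + 1) Lc) Lc j)) (i + 1) (m + 1))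
                (reslot Sum.inl Sum.inr fun κ u => cVH • symVhSAt (toSite rt) 3 Lc rfl κ u) κ' u' x z a b
              - push₃ (-respStep (d := 3) (Lc ^ (i + 1)) (Lc ^ (i + 1 + (m + 1) + 1))) (legComp (colM (KStepUnit (d := 3) Lc (i + 1)) Lc) (respStep (d := 3) (Lc ^ (i + 1 + 1)) (Lc ^ (i + 1 + (m + 1) + 1)))) (respStep (d := 3) (Lc ^ (i + 1)) (Lc ^ (i + 1 + (m + 1) + 1)))
                (reslot Sum.inl Sum.inr fun κ u => cVH • symVhSAt (toSite rt) 3 Lc rfl κ u) κ' u' x z a b)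
            + (push₃ (legComp (rowMM (KStepUnit (d := 3) Lc (i + 1)) Lc) (respStep (d := 3) (Lc ^ (i + 1 + 1)) (Lc ^ (i + 1 + (m + 1) + 1)))) (legChain (fun j => legComp (fun α x κ u => psiKS (ctrOff (3 + 1) Lc) Lc u x (Sum.inl κ) (Sum.inl α)) (respStepBmSeq (d := 3) (ctr (3 + 1) Lc) Lc j)) (i + 1) (m + 1)) (legChain (fun j => legComp (fun α x κ u => psiKS (ctrOff (3 + 1) Lc) Lc u x (Sum.inl κ) (Sum.inl α)) (respStepBmSeq (d := 3) (ctr (3 + 1) Lc) Lc j)) (i + 1) (m + 1))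
                (reslot Sum.inr Sum.inl fun κ u => cVH • symVhSAt (toSite rt) 3 Lc rfl κ u) κ' u' x z a b
              - push₃ (legComp (rowMM (KStepUnit (d := 3) Lc (i + 1)) Lc) (respStep (d := 3) (Lc ^ (i + 1 + 1)) (Lc ^ (i + 1 + (m + 1) + 1)))) (respStep (d := 3) (Lc ^ (i + 1)) (Lc ^ (i + 1 + (m + 1) + 1))) (respStep (d := 3) (Lc ^ (i + 1)) (Lc ^ (i + 1 + (m + 1) + 1)))
                (reslot Sum.inr Sum.inl fun κ u => cVH • symVhSAt (toSite rt) 3 Lc rfl κ u) κ' u' x z a b))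
          - ((push₃ (-legChain (fun j => legComp (fun α x κ u => psiKS (ctrOff (3 + 1) Lc) Lc u x (Sum.inl κ) (Sum.inl α)) (respStepBmSeq (d := 3) (ctr (3 + 1) Lc) Lc j)) i (m + 1)) (legComp (colM (KStepUnit (d := 3) Lc i) Lc) (respStep (d := 3) (Lc ^ (i + 1)) (Lc ^ (i + (m + 1) + 1)))) (legChain (fun j => legComp (fun α x κ u => psiKS (ctrOff (3 + 1) Lc) Lc u x (Sum.inl κ) (Sum.inl α)) (respStepBmSeq (d := 3) (ctr (3 + 1) Lc) Lc j)) i (m + 1))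
                (reslot Sum.inl Sum.inr fun κ u => cVH • symVhSAt (toSite rt) 3 Lc rfl κ u) κ' u' x z a b
              - push₃ (-respStep (d := 3) (Lc ^ i) (Lc ^ (i + (m + 1) + 1))) (legComp (colM (KStepUnit (d := 3) Lc i) Lc) (respStep (d := 3) (Lc ^ (i + 1)) (Lc ^ (i + (m + 1) + 1)))) (respStep (d := 3) (Lc ^ i) (Lc ^ (i + (m + 1) + 1)))
                (reslot Sum.inl Sum.inr fun κ u => cVH • symVhSAt (toSite rt) 3 Lc rfl κ u) κ' u' x z a b)
            + (push₃ (legComp (rowMM (KStepUnit (d := 3) Lc i) Lc) (respStep (d := 3) (Lc ^ (i + 1)) (Lc ^ (i + (m + 1) + 1)))) (legChain (fun j => legComp (fun α x κ u => psiKS (ctrOff (3 + 1) Lc) Lc u x (Sum.inl κ) (Sum.inl α)) (respStepBmSeq (d := 3) (ctr (3 + 1) Lc) Lc j)) i (m + 1)) (legChain (fun j => legComp (fun α x κ u => psiKS (ctrOff (3 + 1) Lc) Lc u x (Sum.inl κ) (Sum.inl α)) (respStepBmSeq (d := 3) (ctr (3 + 1) Lc) Lc j)) i (m + 1))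
                (reslot Sum.inr Sum.inl fun κ u => cVH • symVhSAt (toSite rt) 3 Lc rfl κ u) κ' u' x z a b
              - push₃ (legComp (rowMM (KStepUnit (d := 3) Lc i) Lc) (respStep (d := 3) (Lc ^ (i + 1)) (Lc ^ (i + (m + 1) + 1)))) (respStep (d := 3) (Lc ^ i) (Lc ^ (i + (m + 1) + 1))) (respStep (d := 3) (Lc ^ i) (Lc ^ (i + (m + 1) + 1)))
                (reslot Sum.inr Sum.inl fun κ u => cVH • symVhSAt (toSite rt) 3 Lc rfl κ u) κ' u' x z a b)))|
      ≤ |cVH| * (2 * ((Lc : ℝ) ^ 3 * (((((3 + 1).factorial : ℕ) : ℝ) * (Lc : ℝ) ^ (3 + 1))⁻¹ * (((3 : ℝ) + 1) * (Real.exp (2 * ((3 : ℝ) + 1) * min (min δ κ₁) κ₁) ^ 2 *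
              (((2 * Lc : ℕ) : ℝ) ^ (3 + 1) * (((3 + 1 : ℕ) : ℝ) * ((((3 + 1).factorial : ℕ) : ℝ) * ((Lc : ℝ) ^ (3 + 1) * (ell (3 + 1) Lc : ℝ)))))))
            * ((2 * (Cst * Real.exp δ) * C₁ * (c * θ₁ ^ (i + (m + 1))) + (cK * θ₂ ^ (i + (m + 1)) * Real.exp δ) * C₁ ^ 2) * (4 * ((8 * (Lc : ℝ) + faceWtSum (ctrOff (3 + 1) Lc) Lc * (1 + 8 * (Lc : ℝ) * (Real.exp κ₁ + 1))) * (1 + (Lc : ℝ))) + 4 * ((8 * (Lc : ℝ) + faceWtSum (ctrOff (3 + 1) Lc) Lc * (1 + 8 * (Lc : ℝ) * (Real.exp κ₁ + 1))) * (1 + (Lc : ℝ))) ^ 2 + 4 * ((8 * (Lc : ℝ) + faceWtSum (ctrOff (3 + 1) Lc) Lc * (1 + 8 * (Lc : ℝ) * (Real.exp κ₁ + 1))) * (1 + (Lc : ℝ))) * Lc + 8 * ((8 * (Lc : ℝ) + faceWtSum (ctrOff (3 + 1) Lc) Lc * (1 + 8 * (Lc : ℝ) * (Real.exp κ₁ +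 1))) * (1 + (Lc : ℝ))) ^ 2 * Lc))
            * Zl (3 + 1) (min (min δ κ₁) κ₁ / (4 * ((3 : ℝ) + 1))))))
          * (((((m + 1) : ℕ) : ℝ) + 1) * ((Lc : ℝ)⁻¹) ^ ((m + 1) + 1))
          * Real.exp (-(min (min δ κ₁) κ₁ / 12 / 2 / ((3 : ℝ) + 1)) * (l1 (x - u') + l1 (z - u'))) := by
  have hCst : 0 ≤ Cst := (hK 0).nonneg (Sum.inl 0)
  have hTb : 0 ≤ Cst * Real.exp δ := by positivity
  have hE : ∀ μ z' l u, |legChain (fun j => legComp (fun α x κ u => psiKS (ctrOff (3 + 1) Lc) Lc u x (Sum.inl κ) (Sum.inl α)) (respStepBmSeq (d := 3) (ctr (3 + 1) Lc) Lc j)) i (m + 1) μ z' l u|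
      ≤ (KE * (((m + 1 : ℕ) : ℝ) + 1) * ((Lc : ℝ) ^ (4 * (m + 1 + 1)))⁻¹) * Real.exp (-(κE * supNorm (quo (Lc ^ (m + 1 + 1)) u - z'))) :=
    fun μ z' l u => hEnv i (m + 1) μ z' l u
  have hEp : ∀ μ z' l u, |legChain (fun j => legComp (fun α x κ u => psiKS (ctrOff (3 + 1) Lc) Lc u x (Sum.inl κ) (Sum.inl α)) (respStepBmSeq (d := 3) (ctr (3 + 1) Lc) Lc j)) (i + 1) (m + 1) μ z' l u|
      ≤ (KE * (((m + 1 : ℕ) : ℝ) + 1) * ((Lc : ℝ) ^ (4 * (m + 1 + 1)))⁻¹) * Real.exp (-(κE * supNorm (quo (Lc ^ (m + 1 + 1)) u - z'))) :=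
    fun μ z' l u => hEnv (i + 1) (m + 1) μ z' l u
  have hBΔ : ∀ (μ : Fin (3 + 1)) (z : Site (3 + 1)) (l : Fin (3 + 1)) (u : Site (3 + 1)),
      |respStep (d := 3) (Lc ^ (i + 1)) (Lc ^ (i + 1 + (m + 1) + 1)) μ z l u - respStep (d := 3) (Lc ^ i) (Lc ^ (i + (m + 1) + 1)) μ z l u|
        ≤ (c * θ₁ ^ (i + (m + 1))) * ((Lc : ℝ) ^ (5 * (m + 1 + 1)))⁻¹ * Real.exp (-(κ₁ * supNorm (quo (Lc ^ (m + 1 + 1)) u - z))) := by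
    intro μ z l u
    have h := hCau i (m + 1) μ z l u
    rw [inv_cast_pow_pow, show i + (m + 1) + 2 = i + 1 + (m + 1) + 1 by ring] at h
    simpa only [mul_assoc] using h
  have hr : ctrOff (3 + 1) Lc ∈ box (3 + 1) Lc := ctrOff_mem_box (le_trans (by norm_num) hLc)
  have hA : 0 ≤ ((8 * (Lc : ℝ) + faceWtSum (ctrOff (3 + 1) Lc) Lc * (1 + 8 * (Lc : ℝ) * (Real.exp κ₁ + 1))) * (1 + (Lc : ℝ))) := by
    have hF0 := faceWtSum_nonneg (ctrOff (3 + 1) Lc) Lc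
    positivity
  have hTB := combLegChain_sub_respStep (d := 3) (Lc := Lc) hr hr i (m + 1)
  have hTBp := combLegChain_sub_respStep (d := 3) (Lc := Lc) hr hr (i + 1) (m + 1)
  obtain ⟨G, Gp, GΔ, hψ', hG', hψp', hGp', hψΔ', hGΔ'⟩ :=
    exists_combGauge_staircase_merged_pair (Lc := Lc) hκ₁.le hC₁ hκ₁.le hc hθ₁ hN1 hCau hr hr le_rfl i (m + 1)
  have hψ : ∀ (μ₀ : Fin (3 + 1)) (z₀ u : Site (3 + 1)),
      (Psi (toSite (ctrOff (3 + 1) Lc)) Lc i (m + 1) (delta1 μ₀ z₀) + PsiFace (ctrOff (3 + 1) Lc) (toSite (ctrOff (3 + 1) Lc)) Lc i (m + 1) (delta1 μ₀ z₀)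
          - bmGaugeAt (toSite (ctrOff (3 + 1) Lc)) (respStep (d := 3) (Lc ^ i) (Lc ^ (i + (m + 1) + 1)) μ₀ z₀) Lc) u
        = ∑ s ∈ Finset.range ((m + 1) + 1), G μ₀ z₀ s (blk (Lc ^ s) u) := fun μ₀ z₀ u => by
    simpa only [Pi.add_apply, Pi.sub_apply] using hψ' μ₀ z₀ u
  have hψq : ∀ (μ₀ : Fin (3 + 1)) (z₀ u : Site (3 + 1)),
      (Psi (toSite (ctrOff (3 + 1) Lc)) Lc (i + 1) (m + 1) (delta1 μ₀ z₀) + PsiFace (ctrOff (3 + 1) Lc) (toSite (ctrOff (3 + 1) Lc)) Lc (i + 1) (m + 1) (delta1 μ₀ z₀)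
          - bmGaugeAt (toSite (ctrOff (3 + 1) Lc)) (respStep (d := 3) (Lc ^ (i + 1)) (Lc ^ (i + 1 + (m + 1) + 1)) μ₀ z₀) Lc) u
        = ∑ s ∈ Finset.range ((m + 1) + 1), Gp μ₀ z₀ s (blk (Lc ^ s) u) := fun μ₀ z₀ u => by
    simpa only [Pi.add_apply, Pi.sub_apply] using hψp' μ₀ z₀ u
  have hψΔ : ∀ (μ₀ : Fin (3 + 1)) (z₀ u : Site (3 + 1)),
      (Psi (toSite (ctrOff (3 + 1) Lc)) Lc (i + 1) (m + 1) (delta1 μ₀ z₀) + PsiFace (ctrOff (3 + 1) Lc) (toSite (ctrOff (3 + 1) Lc)) Lc (i + 1) (m + 1) (delta1 μ₀ z₀)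
          - bmGaugeAt (toSite (ctrOff (3 + 1) Lc)) (respStep (d := 3) (Lc ^ (i + 1)) (Lc ^ (i + 1 + (m + 1) + 1)) μ₀ z₀) Lc) u
        - (Psi (toSite (ctrOff (3 + 1) Lc)) Lc i (m + 1) (delta1 μ₀ z₀) + PsiFace (ctrOff (3 + 1) Lc) (toSite (ctrOff (3 + 1) Lc)) Lc i (m + 1) (delta1 μ₀ z₀)
          - bmGaugeAt (toSite (ctrOff (3 + 1) Lc)) (respStep (d := 3) (Lc ^ i) (Lc ^ (i + (m + 1) + 1)) μ₀ z₀) Lc) u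
        = ∑ s ∈ Finset.range ((m + 1) + 1), GΔ μ₀ z₀ s (blk (Lc ^ s) u) := fun μ₀ z₀ u => by
    simpa only [Pi.add_apply, Pi.sub_apply] using hψΔ' μ₀ z₀ u
  have hGA : ∀ (μ₀ : Fin (3 + 1)) (z₀ : Site (3 + 1)) (s : ℕ), s ≤ (m + 1) → ∀ u : Site (3 + 1),
      |G μ₀ z₀ s (blk (Lc ^ s) u)| ≤ ((8 * (Lc : ℝ) + faceWtSum (ctrOff (3 + 1) Lc) Lc * (1 + 8 * (Lc : ℝ) * (Real.exp κ₁ + 1))) * (1 + (Lc : ℝ))) * C₁ * ((Lc : ℝ) ^ (5 * ((m + 1) + 1)))⁻¹ * (Lc : ℝ) ^ s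
        * Real.exp (-(κ₁ * supNorm (quo (Lc ^ ((m + 1) + 1)) u - z₀))) := fun μ₀ z₀ s hs u =>
    (hG' μ₀ z₀ s hs u).trans (le_of_eq (by ring))
  have hGqA : ∀ (μ₀ : Fin (3 + 1)) (z₀ : Site (3 + 1)) (s : ℕ), s ≤ (m + 1) → ∀ u : Site (3 + 1),
      |Gp μ₀ z₀ s (blk (Lc ^ s) u)| ≤ ((8 * (Lc : ℝ) + faceWtSum (ctrOff (3 + 1) Lc) Lc * (1 + 8 * (Lc : ℝ) * (Real.exp κ₁ + 1))) * (1 + (Lc : ℝ))) * C₁ * ((Lc : ℝ) ^ (5 * ((m + 1) + 1)))⁻¹ * (Lc : ℝ) ^ s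
        * Real.exp (-(κ₁ * supNorm (quo (Lc ^ ((m + 1) + 1)) u - z₀))) := fun μ₀ z₀ s hs u =>
    (hGp' μ₀ z₀ s hs u).trans (le_of_eq (by ring))
  have hGΔ : ∀ (μ₀ : Fin (3 + 1)) (z₀ : Site (3 + 1)) (s : ℕ), s ≤ (m + 1) → ∀ u : Site (3 + 1),
      |GΔ μ₀ z₀ s (blk (Lc ^ s) u)| ≤ ((8 * (Lc : ℝ) + faceWtSum (ctrOff (3 + 1) Lc) Lc * (1 + 8 * (Lc : ℝ) * (Real.exp κ₁ + 1))) * (1 + (Lc : ℝ))) * (c * θ₁ ^ (i + (m + 1))) * ((Lc : ℝ) ^ (5 * ((m + 1) + 1)))⁻¹ * (Lc : ℝ) ^ s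
        * Real.exp (-(κ₁ * supNorm (quo (Lc ^ ((m + 1) + 1)) u - z₀))) := fun μ₀ z₀ s hs u =>
    (hGΔ' μ₀ z₀ s hs u).trans (le_of_eq (by ring))
  obtain ⟨N, CM, mM, hmM, hcol, hrow⟩ := exists_legDecay_mulLegs (d := 3) (Lc := Lc) i (m + 1)
  obtain ⟨Np, CMp, mMp, hmMp, hcolp, hrowp⟩ := exists_legDecay_mulLegs (d := 3) (Lc := Lc) (i + 1) (m + 1)
  have hMt := fun (a : Fin (3 + 1)) (b : Site (3 + 1)) (μ : Fin (3 + 1)) (y : Site (3 + 1)) => abs_legComp_colM_zsmul_le hK hδ.le i (m + 1) a b μ y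
  have hMpt := fun (a : Fin (3 + 1)) (b : Site (3 + 1)) (μ : Fin (3 + 1)) (y : Site (3 + 1)) => abs_legComp_colM_zsmul_le hK hδ.le (i + 1) (m + 1) a b μ y
  have hMΔt := fun (a : Fin (3 + 1)) (b : Site (3 + 1)) (μ : Fin (3 + 1)) (y : Site (3 + 1)) =>
    abs_legComp_colM_zsmul_sub_le hKall hδ.le hcK hθ₂ i (m + 1) a b μ y
  have hM't := fun (a : Fin (3 + 1)) (b : Site (3 + 1)) (μ : Fin (3 + 1)) (y : Site (3 + 1)) => abs_legComp_rowMM_zsmul_le hK hδ.le i (m + 1) a b μ y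
  have hM'Δt := fun (a : Fin (3 + 1)) (b : Site (3 + 1)) (μ : Fin (3 + 1)) (y : Site (3 + 1)) =>
    abs_legComp_rowMM_zsmul_sub_le hKall hδ.le hcK hθ₂ i (m + 1) a b μ y
  exact abs_weight_mul_comb_contact_v_pair_le_three (cVH := cVH) (i := i) (n := m + 1) hLc hrt hcE hN1 hκ₁ hC₁ hκ₁ (by positivity : 0 ≤ c * θ₁ ^ (i + (m + 1))) hBΔ hA hTB hTBp hψ hψq hψΔ hGA hGqA hGΔ hE hEp hκE
    (hcol.summable hmM) (hcolp.summable hmMp) hMt hMpt hMΔt (fun a b μ z => hrow.abs_le hmM.le a b μ z) (hrow.summable hmM)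
    (fun a b μ z => hrowp.abs_le hmMp.le a b μ z) (hrowp.summable hmMp) hM't hM'Δt hδ hTb (by positivity) κ' u' x z a b

end Cells

end Summit.QuantumFields.BalabanUV.Beta.GAN24.CombBornBorderContactPairCells

end
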